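import Summits.QuantumFields.YangMills.Theorems.BalabanUVNodesN22AtRecordOfTermDataTableGermsLocatedRadiiDilatedMembers
import Summits.QuantumFields.YangMills.Theorems.BalabanUVNodesN22W1RelCentredMembersOfDatumOfLocatedRecords
import Literature.MathematicalPhysics.QuantumFieldTheory.Balaban1983to89.Node00.HistoryTermDatum214LocalGrowthAnalytic

/-!
# BalabanUVNodes ∕ node N22 = NE9 — THE ROAD-2 SOCKET OF RECORD IN LEMMA 2's OWN CURRENCY (module J89 = module J88 with the local growth record PRODUCED from node00-def-W1's
# W1-12b `AnalyticGrowthInputs` by `LocalGrowthInputs.ofAnalytic`): per slice, base point and admissible history the located family carries NODE A's kernel record `Inputs226Holo`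
# and LEMMA 2's SENTENCE — complex-analytic potentials `𝒲ᶜ(Y,·), 𝒪ᶜ(Y,·)` on ONE sup-ball of radius `R`, per-domain sup bounds `M𝒲(Y), M𝒪(Y)`, third-order onset of the Wilson
# remainder, `Y`-locality ([II] (1.34)–(1.36), (1.39), Lemma 2 (1.41)–(1.43)) — plus the located non-Lemma-2 data (box radius `ρ < R`, τ-radii, cube-location, (2.19) profile, box-support law)

Cell `pub-ymgap`, HUMAN RULING D-0062 (Track A), R134 seat `pub-ymgap-dag-n22-c` (strategy s1: «the history-Lipschitz estimate (2.40)–(2.41) p. 21 of [II] on the W1 object»), generation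
21, module J89.  THEOREMS ONLY (no `def`, no `sorry`, standard axioms); `--kind proof --supports stmt-QuantumFields-27366 --as helper` (K3⁸ `SpineGivenEndpointR13SepCoPHV`), COUNT-NEUTRAL.
Imports this lane's module J86 `…N22AtRecordOfTermDataTableGermsLocatedRadiiDilatedMembers` (ROAD-2 socket at the members), module J88-A `…N22W1RelCentredMembersOfDatumOfLocatedRecords` (the four
member statements read off `(ι, lg)`) and node00-def-W1's W1-12b `Node00/HistoryTermDatum214LocalGrowthAnalytic` (`AnalyticGrowthInputs` = Lemma 2's sentence `Lemma2Inputs` extended by the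
located data; the constructor `LocalGrowthInputs.ofAnalytic` with its `rfl` faces `ofAnalytic_ρ ∕ _R ∕ _c₀ ∕ _c₁ ∕ _c₃ ∕ _c₄ ∕ _m₃ …`).  Nothing re-declared; consumed BY NAME.

WHY.  Module J88 (this generation) keys the member statements on W1-12's `LocalGrowthInputs` — Lemma 2's CONSEQUENCES in letter form ((L0)–(L6), (ℓ1): Taylor-type growth letters with
constants `c₀ … c₄`, the cubic ∕ linear leading parts as data).  Print's statement is Lemma 2's SENTENCE ([II] p. 11 with (1.34) p. 9: the localized potentials are «defined and analytic
on … {B′ : e^{16κ₁}|B′| ≤ a₁ on Y}», bounded by (1.36) ∕ (1.39), the Wilson remainder of third order, reading the field inside `Y`), and node00-def-W1's W1-12b types exactly that sentence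
per slice and history as `Lemma2Inputs` ⊂ `AnalyticGrowthInputs`, with `LocalGrowthInputs.ofAnalytic` DERIVING every letter (`𝒲₃ := cubicPart 𝒲ᶜ`, `D𝒪 := linPart 𝒪ᶜ`, `c₃ = c₃′ := M𝒲∕R³`,
`c₄ := 2M𝒲∕R⁴`, `c₀ := M𝒪`, `c₁ = c₁′ := 2M𝒪∕R`, `c₂ := 4M𝒪∕R²`, (L0)–(L6) ∕ (ℓ1) by module 48) — the K3⁸-level twin of this lane's g10 move `SliceInputsLG ↦ SliceInputsL2U`.  THIS FILE is
module J88's text with `∃ lg : LocalGrowthInputs …` REPLACED by `∃ ag : AnalyticGrowthInputs (χu K k) (𝒲 K k) (𝒪 K k) Z s old φ ι.Uτ` and the rows (r3) written in Lemma 2's letters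
(`(1+ρ_b)²·2ρ·(C_p K₀) ≤ a_m`, `(1+ρ_b)²·Σ Rτ(M𝒪 + (2M𝒪∕R)ρ) ≤ w_m`, `2δ + 8ρ·(C_p K₀) ≤ a_m`, `hwc` at `c₄ = 2M𝒲∕R⁴, c₃ = c₃′ = M𝒲∕R³, c₂ = 4M𝒪∕R², c₁ = c₁′ = 2M𝒪∕R, c₀ = M𝒪`); proof = J88's with
`lg := LocalGrowthInputs.ofAnalytic ag` (the rows match by `rfl`).
* §1 ★★★ socket `n22At_u3OfRecord₁₃_of_kernelStepRate_termDataTableGermsLocatedRadiiMembersOfLemma2RecordsNonexpansive` — binder diff vs J88: inside `hιc`, `lg : LocalGrowthInputs ↦ ag : AnalyticGrowthInputs`, rows (r3) in Lemma 2's letters.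
THE N22 ROAD-2 BILL AT def-W1's TERM DATA AFTER J89: N18's rate `h5`; (1.21) `hlim`; W1-20's law `hloc`; NODE A's located (2.26) records `hι`, `hloc18`, and `hιc` = per slice, base point and
admissible history NODE A's kernel record `ι` + LEMMA 2's SENTENCE with located data `ag` + the rows; def-W1's laws; chart DATA; numerics.  Every N22-side analytic input is a located
primitive record (NODE A's kernel letters, N09's Lemma 2 sentence for the law's potentials, the box laws) or a law.

HONEST FRAMING (binding).  Count-neutral INSTANCE of module J86 BY NAME with module J88-A at `lg := LocalGrowthInputs.ofAnalytic ag`; `hιc`, the located records, the laws, the chart data,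
the numerics and every other binder are DISPLAYED HYPOTHESES (NODE A's ∕ N09's ∕ N10's ∕ N18's standing displayed class; GAPS G-ne9p2-5 ∕ G-t4-U3-1); NO estimate of Bałaban's — in
particular NOT Lemma 2 — is proved or asserted; nothing of the record is constructed or claimed to meet the displayed inputs (A6: this lane's J88-W inhabits J88's family at degenerate data;
the `AnalyticGrowthInputs` edition is inhabited by the zero complex potentials likewise — not exhibited here).  N18, N10 and N22 are NOT discharged (typed 28∕28; count per dag-lead TABLE —
N22 unchanged); K3⁸ OPEN and NOT claimed; NE9 ∕ NE5 NOT IN PRINT for d = 4; no count claim; one finite 𝕋⁴ programme at fixed ε — R4 closes the CONDITIONAL rung `BalabanLadder.UV` only;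
NOTHING about the continuum limit, ℝ⁴, infinite volume, OS axioms, a mass gap or the Clay problem is proved or claimed.
References (TYPES only): [II] = Bałaban, CMP 116 (1988) (1.34)–(1.36) p. 9, (1.38)–(1.39) p. 10, Lemma 2 (1.41)–(1.43) p. 11, (2.2)–(2.3) p. 12, (2.13)–(2.15) pp. 14–15, (2.16)–(2.22) p. 16,
(2.23)–(2.26) p. 17, Lemma 3 (2.38) p. 20, (2.39)–(2.41) p. 21, (1.26) p. 8; [I] = CMP 109 (1987) §1 p. 263, (2.8)–(2.13) pp. 266–268; Kotecký–Preiss, CMP 103 (1986) Thm p. 492; King, CMP 102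
(1986) Lemma 4.5 (4.38).
-/
noncomputable section

open Set Metric
open scoped BigOperators

namespace YMDAG.N22.KernelFading

open Literature.MathematicalPhysics.QuantumFieldTheory.Balaban1983to89
open Literature.MathematicalPhysics.QuantumFieldTheory.Balaban1983to89.T4Continuum (T4Family ULoop)
open Literature.MathematicalPhysics.QuantumFieldTheory.Balaban1983to89.T4OutputRate (Window NE9)
open Literature.MathematicalPhysics.QuantumFieldTheory.Balaban1983to89.TreeLengthTorus (TPt TDom tsys torusTreeLen)
open Literature.MathematicalPhysics.QuantumFieldTheory.Balaban1983to89.B9Thm37GlueTorus (tdist1)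
open Literature.MathematicalPhysics.QuantumFieldTheory.Balaban1983to89.B12TreeDecay (K₀ kappa₀)
open Literature.MathematicalPhysics.QuantumFieldTheory.Balaban1983to89.B12Decay510 (delta1)
open Literature.MathematicalPhysics.QuantumFieldTheory.Balaban1983to89.B12Decay510Window (K₁)
open Literature.MathematicalPhysics.QuantumFieldTheory.Balaban1983to89.B12Decay510Torus (distCT nearT)
open Literature.MathematicalPhysics.QuantumFieldTheory.Balaban1983to89.B13Lemma3TorusData (TBond)
open Literature.MathematicalPhysics.QuantumFieldTheory.Balaban1983to89.B13Lemma3TorusTerms (terms weight)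
open Literature.MathematicalPhysics.QuantumFieldTheory.Balaban1983to89.B13Lemma3TorusSocket (Lemma3Numerics)
open Literature.MathematicalPhysics.QuantumFieldTheory.Balaban1983to89.B13OlderTermsTableGerms (Pot cv ρ)
open Literature.MathematicalPhysics.QuantumFieldTheory.Balaban1983to89.Node00 (Stage13Params Stage13HParams U3Letters₁₁ MatA)
open Literature.MathematicalPhysics.QuantumFieldTheory.Balaban1983to89.Node00.Sect2 (domSys domCount CPair)
open Literature.MathematicalPhysics.QuantumFieldTheory.Balaban1983to89.Node00.W1
open Literature.MathematicalPhysics.QuantumFieldTheory.Balaban1983to89.Node00.LocalizedSum17 (ReadingMaps Localizes17OfRecord₁₃)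
open Literature.MathematicalPhysics.QuantumFieldTheory.Balaban1983to89.Node00.U3OfKernels (histPrefix objectsOfRecord₁₃)
open Literature.MathematicalPhysics.QuantumFieldTheory.Balaban1983to89.Node00.U3KernelLetters (KernelStepRateOfRecord₁₃ PolLimitsExistOfRecord₁₃)
open YMDAG.UVSplit (N22At u3OfRecord₁₃ RateReading₁₃CoPH rateCarriersOfRecord₁₃CoPH)
open YMDAG.N22.AtKernels (n22At_u3OfRecord₁₃_objectsOfRecord₁₃_iff)
open YMDAG.N10 (lastCouplingSectors_ofTerms_of_termSectors)
open YMDAG.N22.TermRecursion (genT1last_of_lastSectorHolo genT2last_of_lastSectorHolo)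

open YMDAG.N22.W1 (isOpen_relSector closedBall_subset_relSector differentiableOn_relSector_of_members norm_le_relSector_of_members
  norm_sub_le_sq_relSector_of_members)

open YMDAG.N22.W1 (radius_pos_of_aperture differentiableOn_and_norm_memberTF_le_weight_of_records norm_memberTF_sub_centre_le_of_records
  norm_centre_le_weight_of_records)
open Literature.MathematicalPhysics.QuantumFieldTheory.Balaban1983to89.B13Term214 (term214 core214 F214)

open scoped Matrix Matrix.Norms.L2Operator

variable (F : T4Family) (N : ℕ) [NeZero N] {𝔸 : Type} [NormedRing 𝔸] [NormedAlgebra ℂ 𝔸]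

/-! ## §1 ★★★ The kernel-face socket with the member statements read off NODE A's kernel record and LEMMA 2's SENTENCE (J88-A at `ofAnalytic`) -/

open Classical Finset in
/-- ★★★ **THE ROAD-2 KERNEL-FACE SOCKET IN LEMMA 2's CURRENCY** — module J86 with the coupling-blind centre `T₀ K k Z s old φ := if |P(s)| = 0 then term(A, Γ, F214 |P| 1 1 𝐃 (Y ↦ 𝒪 K k Z s old φ Y 0))
else 0` and `hMdiff ∕ hMbd ∕ hT₀ ∕ hMcen` from module J88-A §1 ∕ §3 ∕ §2 AT `lg := LocalGrowthInputs.ofAnalytic ag`, per slice from the located family `hιc` (`ι : (𝔇 K k).Inputs226Holo c Z s ↑t old φ a a₅`,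
`ag : (𝔇 K k).AnalyticGrowthInputs (χu K k) (𝒲 K k) (𝒪 K k) Z s old φ ι.Uτ` = Lemma 2's sentence + located data, and the rows (r1)–(r6) in Lemma 2's letters), the box laws `hBox ∕ hχ1`, the unscaled boxes at `t`
by `hlaw` ⟹ **`N22At (u3OfRecord₁₃ θ (objectsOfRecord₁₃ F N θ ℓ) k)` for EVERY run length `k`** (plug = J88's list with `lg ↦ ag`).  LOCATED (hypothesis form); N22 NOT discharged; Lemma 2 NOT proved here. [folklore] -/
theorem n22At_u3OfRecord₁₃_of_kernelStepRate_termDataTableGermsLocatedRadiiMembersOfLemma2RecordsNonexpansive (θ : Stage13Params F N) (ℓ : U3Letters₁₁) (hs : ℓ.Signs) (hγ : 0 < θ.γ)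
    (hlim : PolLimitsExistOfRecord₁₃ F N θ) {κ₅ C₅ : ℝ} (hC₅ : 0 ≤ C₅) (h5 : KernelStepRateOfRecord₁₃ F N θ κ₅ ℓ.θ₅ C₅)
    (m' : ℕ) (M : ℕ) [NeZero M] (hM : M = F.L ^ m')
    {c₀ : B13.Consts} {L : ℕ} [NeZero L] (𝔇 : (K : ℕ) → TermData214 c₀ (F.P K) 𝔸 M L) (emb : ReadingMaps F (MatA N) 𝔸)
    (hloc : Localizes17OfRecord₁₃ F N θ (fun K => truncRun K (toClusterTower (𝔇 K).Gn)) emb)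
    (sp : (K j : ℕ) → (domSys (F.P K) M j).Dom → Set (CPair (F.P K) 𝔸))
    (hsp : ∀ (K j : ℕ) (Y : (domSys (F.P K) M j).Dom), IsOpen (sp K j Y))
    {κ κE δ₀ B₃ r R E₀ ϱ Mb cw cS Bq r₁ : ℝ} {aw : ℕ → ℕ → ℕ → ℝ}
    (hκ₀ : kappa₀ (4 * 2 ^ 4) (2 * 4) ≤ κ / 2) (hδ₀ : 0 < δ₀) (hB₃ : 0 ≤ B₃) (hr : 0 < r) (hκE : κ ≤ κE) (hκE0 : 0 ≤ κE) (hE₀ : 0 ≤ E₀)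
    (big : (K j : ℕ) → (domSys (F.P K) M j).Dom → Set (CPair (F.P K) 𝔸))
    (hbigo : ∀ (K k : ℕ) (Z : (domSys (F.P K) M (k + 1)).Dom), IsOpen (big K (k + 1) Z))
    (hrestr : ∀ (K k : ℕ), SpRestr (sp K (k + 1))) (hbig : ∀ (K k : ℕ) (Z : (domSys (F.P K) M (k + 1)).Dom), sp K (k + 1) Z ⊆ big K (k + 1) Z)
    (c : B13.Consts) (hL : 8 ≤ c.L) (hLc : c.L = L) (hκ₁ : 1 ≤ c.κ₁) (hα₆ : c.α₆ ≠ 0) {a a₂ a₂' a₅ Aabs : ℝ} (hN : Lemma3Numerics c M ((c.L : ℝ) / 2) a a₂ a₂' a₅ Aabs)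
    {D : ℕ → Set ℂ}
    (hloc18 : ∀ (K k : ℕ), ∀ s ∈ D K, ∀ old : OlderTerms (F.P K) 𝔸 M k,
      (∀ (j : Fin (k + 1)) (Y : (domSys (F.P K) M j).Dom), ∀ ψ ∈ sp K j Y, ‖old j Y ψ‖ ≤ E₀ * Real.exp (-(r₁ * (domSys (F.P K) M j).dj Y))) →
      (∀ (j : Fin (k + 1)) (Y : (domSys (F.P K) M j).Dom), AnalyticOnNhd ℂ (old j Y) (sp K j Y)) →
      ∀ (Z : (domSys (F.P K) M (k + 1)).Dom), ∀ t ∈ terms L M Z, ∀ φ₁ ∈ big K (k + 1) Z, ∃ ι : (𝔇 K k).Inputs226Holo c Z t s old φ₁ a a₅,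
        (∀ φ ∈ big K (k + 1) Z, ∀ i j, DifferentiableOn ℂ (fun σ => (𝔇 K k).A Z t φ σ i j) {σ | ∀ j, σ j ∈ ι.Uσ}) ∧
        (∀ φ ∈ big K (k + 1) Z, ∀ i j, DifferentiableOn ℂ (fun σ => ((𝔇 K k).𝒦 Z t).G2 σ ((𝔇 K k).uOf Z t φ) i j) {σ | ∀ j, σ j ∈ ι.Uσ}) ∧
        (∀ σ : TPt (F.P K).d (domCount (F.P K) M (k + 1)) → ℂ, (∀ j, σ j ∈ ι.Uσ) → ∀ i j, DifferentiableOn ℂ (fun φ => (𝔇 K k).A Z t φ σ i j) (big K (k + 1) Z)) ∧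
        (∀ σ : TPt (F.P K).d (domCount (F.P K) M (k + 1)) → ℂ, (∀ j, σ j ∈ ι.Uσ) →
          ∀ i j, DifferentiableOn ℂ (fun φ => ((𝔇 K k).𝒦 Z t).G2 σ ((𝔇 K k).uOf Z t φ) i j) (big K (k + 1) Z)) ∧
        (∀ Y B, DifferentiableOn ℂ (fun φ => (𝔇 K k).𝒱 Z t s old φ Y B) (big K (k + 1) Z)) ∧
        (∀ φ ∈ big K (k + 1) Z, ∀ Y, Measurable ((𝔇 K k).𝒱 Z t s old φ Y)) ∧
        (∀ φ ∈ big K (k + 1) Z, ∀ σ : TPt (F.P K).d (domCount (F.P K) M (k + 1)) → ℂ, (∀ j, σ j ∈ ι.Uσ) → ((𝔇 K k).A Z t φ σ).IsSymm) ∧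
        (∀ φ ∈ big K (k + 1) Z, ∀ σ : TPt (F.P K).d (domCount (F.P K) M (k + 1)) → ℂ, (∀ j, σ j ∈ ι.Uσ) → (((𝔇 K k).A Z t φ σ).map Complex.re).PosDef) ∧
        (∀ φ ∈ big K (k + 1) Z, ∀ τ : TDom (F.P K).d (L * domCount (F.P K) M (k + 1)) → ℂ, (∀ Y, τ Y ∈ ι.Uτ Y) →
          ∀ B, ∑ Y ∈ t.1, ‖τ Y‖ * ‖(𝔇 K k).𝒱 Z t s old φ Y B‖ ≤ ι.a₂₀ / 2 * (B ⬝ᵥ B) + ι.w) ∧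
        (∀ φ ∈ big K (k + 1) Z, ∀ σ : TPt (F.P K).d (domCount (F.P K) M (k + 1)) → ℂ, (∀ j, σ j ∈ ι.Uσ) → ∀ b j, ‖((𝔇 K k).𝒦 Z t).G2 σ ((𝔇 K k).uOf Z t φ) b j‖ ≤
            ι.KG * Real.exp (-(ι.kap * tdist1 (𝔇 K k).Nf (((𝔇 K k).𝒦 Z t).locΛ b) (((𝔇 K k).𝒦 Z t).locN j)))) ∧
        (∀ φ ∈ big K (k + 1) Z, ∀ σ : TPt (F.P K).d (domCount (F.P K) M (k + 1)) → ℂ, (∀ j, σ j ∈ ι.Uσ) → ∀ b b', ‖((𝔇 K k).A Z t φ σ)⁻¹ b b'‖ ≤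
            ι.KCs * Real.exp (-(ι.kap * tdist1 (𝔇 K k).Nf (((𝔇 K k).𝒦 Z t).locΛ b) (((𝔇 K k).𝒦 Z t).locΛ b')))) ∧
        (∀ φ ∈ big K (k + 1) Z, ∀ σ : TPt (F.P K).d (domCount (F.P K) M (k + 1)) → ℂ, (∀ j, σ j ∈ ι.Uσ) →
          ∀ b j, ‖(((𝔇 K k).𝒦 Z t).G2 σ ((𝔇 K k).uOf Z t φ) - ((𝔇 K k).𝒦 Z t).Γ₀.map (algebraMap ℝ ℂ)) b j‖ ≤
            ι.θΓ * Real.exp (-(ι.kap * tdist1 (𝔇 K k).Nf (((𝔇 K k).𝒦 Z t).locΛ b) (((𝔇 K k).𝒦 Z t).locN j)))) ∧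
        (∀ φ ∈ big K (k + 1) Z, ∀ σ : TPt (F.P K).d (domCount (F.P K) M (k + 1)) → ℂ, (∀ j, σ j ∈ ι.Uσ) →
          ∀ b b', ‖(((𝔇 K k).A Z t φ σ)⁻¹ - ((𝔇 K k).𝒦 Z t).C.map (algebraMap ℝ ℂ)) b b'‖ ≤
            ι.θC * Real.exp (-(ι.kap * tdist1 (𝔇 K k).Nf (((𝔇 K k).𝒦 Z t).locΛ b) (((𝔇 K k).𝒦 Z t).locΛ b')))) ∧
        (∀ φ ∈ big K (k + 1) Z, ∀ σ : TPt (F.P K).d (domCount (F.P K) M (k + 1)) → ℂ, (∀ j, σ j ∈ ι.Uσ) →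
          ∀ b b', ‖((𝔇 K k).A Z t φ σ - ((𝔇 K k).𝒦 Z t).C⁻¹.map (algebraMap ℝ ℂ)) b b'‖ ≤
            ι.θE * Real.exp (-(ι.kap * tdist1 (𝔇 K k).Nf (((𝔇 K k).𝒦 Z t).locΛ b) (((𝔇 K k).𝒦 Z t).locΛ b')))))
    (hD : ∀ K, ∀ t ∈ Ioc (0 : ℝ) θ.γ, ((t : ℝ) : ℂ) ∈ D K)
    {S : ℕ → ℕ → Type} [∀ K k, MeasurableSpace (S K k)] [∀ K k, TopologicalSpace (S K k)] [∀ K k, OpensMeasurableSpace (S K k)]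
    (χu χcu : (K k : ℕ) → (𝔇 K k).UnscaledChi) (𝒲 : (K k : ℕ) → (𝔇 K k).UnscaledWilson) (𝒪 : (K k : ℕ) → (𝔇 K k).UnscaledOlder)
    (Rd : (K k : ℕ) → (Z : (domSys (F.P K) M (k + 1)).Dom) → (t : TermLabel (F.P K) M k L) → (𝔇 K k).ReadingAtoms Z t (S K k))
    (W : (K k : ℕ) → (domSys (F.P K) M (k + 1)).Dom → TermLabel (F.P K) M k L → Set (CPair (F.P K) 𝔸))
    (hlaw : ∀ K, (𝔇 K).UnscaledFieldLawOn (χu K) (χcu K) (𝒲 K) (𝒪 K) θ.γ) (hread : ∀ K k, (𝔇 K k).ReadsBy (𝒪 K k) (Rd K k))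
    (hmaps : ∀ (K k : ℕ) (Z : (domSys (F.P K) M (k + 1)).Dom) (t : TermLabel (F.P K) M k L), (Rd K k Z t).MapsToTables (sp K) (W K k Z t) univ)
    (hW : ∀ (K k : ℕ) (X Z : (domSys (F.P K) M (k + 1)).Dom), Subtype.val Z ⊆ Subtype.val X → ∀ s ∈ terms L M Z, sp K (k + 1) X ⊆ W K k Z s)
    (hcont : ∀ (K k : ℕ) (Z : (domSys (F.P K) M (k + 1)).Dom) (t : TermLabel (F.P K) M k L), (Rd K k Z t).CfgContinuous)
    (hjc : ∀ (K k : ℕ) (Z : (domSys (F.P K) M (k + 1)).Dom) (t : TermLabel (F.P K) M k L), (Rd K k Z t).CfgJointContinuous)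
    {Ck mk : ℝ} (hK : ∀ (K k : ℕ) (Z : (domSys (F.P K) M (k + 1)).Dom) (t : TermLabel (F.P K) M k L), (Rd K k Z t).KernelBounded Ck)
    (hμ : ∀ (K k : ℕ) (Z : (domSys (F.P K) M (k + 1)).Dom) (t : TermLabel (F.P K) M k L), (Rd K k Z t).FiniteMass mk) (hCk : 0 ≤ Ck) (hmk : 0 ≤ mk)
    (hWm : ∀ (K k : ℕ) (Z : (domSys (F.P K) M (k + 1)).Dom) (t : TermLabel (F.P K) M k L) (φ : CPair (F.P K) 𝔸) (Y : TDom (F.P K).d (L * domCount (F.P K) M (k + 1))),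
      Measurable fun B : ((𝔇 K k).𝒦 Z t).Λ → ℝ => 𝒲 K k Z t φ Y B)
    {b : ℝ} (hb : 0 < b) (hbaw : ∀ K k j, b ≤ aw K k j)
    (hι : ∀ (K k : ℕ), ∀ t ∈ Ioc (0 : ℝ) θ.γ, ∀ (X : (domSys (F.P K) M (k + 1)).Dom), ∀ φ ∈ sp K (k + 1) X,
      ∀ Z : (domSys (F.P K) M (k + 1)).Dom, Subtype.val Z ⊆ Subtype.val X → ∀ s ∈ terms L M Z,
        ∃ old₀ ∈ AdmHist (sp K) E₀ r₁ k, ∃ ι : (𝔇 K k).Inputs226Holo c Z s ((t : ℝ) : ℂ) old₀ φ a a₅, ∃ w₀ : ℝ,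
          (∀ τ : TDom (F.P K).d (L * domCount (F.P K) M (k + 1)) → ℂ, (∀ Y, τ Y ∈ ι.Uτ Y) → ∀ B : ((𝔇 K k).𝒦 Z s).Λ → ℝ,
            ∑ Y ∈ s.1, ‖τ Y‖ * ‖(𝔇 K k).𝒱 Z s ((t : ℝ) : ℂ) old₀ φ Y B‖ ≤ ι.a₂₀ / 2 * (B ⬝ᵥ B) + w₀) ∧
          w₀ + (∑ Y ∈ s.1, ((B13Bound143.invTau c ((tsys (F.P K).d (L * domCount (F.P K) M (k + 1))).dj Y))⁻¹ + (𝔇 K k).r + 2)) *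
            ((∑ _j : Fin (k + 1), ∑ _X : (domSys (F.P K) M _j).Dom, Ck) * mk * (E₀ + b⁻¹ * R)) ≤ ι.w)
    (hA0 : 0 ≤ c.C3act * c.ε₁) (hr₁ : 0 ≤ r₁) (hrate : r₁ + 2 * (64 * Real.log 162) + 2 ≤ (1 - 8 * c.δ) * ((c.L : ℝ) / 2) * c.κ)
    (hKP : c.C3act * c.ε₁ * Real.exp (5 * r₁ + 1) * K₀ 64 8 * 9 * 64 < 1) (hκr : κE ≤ r₁) (hrenew : Real.exp 1 * 9 * 64 * K₀ 64 8 ^ 2 * (c.C3act * c.ε₁) ≤ Mb)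
    (hrenewE : Real.exp 1 * 9 * 64 * K₀ 64 8 ^ 2 * (c.C3act * c.ε₁) ≤ E₀)
    (hawcw : ∀ K k j, aw K k j ≤ cw) (hC1 : 4 * Mb * cw / ϱ < 1)
    (hMb0 : 0 ≤ Mb) (hϱ : 0 < ϱ) (hR : cw * E₀ + ϱ < R)
    {cA ρb Mv : ℝ} (hcS : 0 < cS) (hcSA : cS < cA) (hcA1 : cA < 1) (hρb : cA / (1 - cA) < ρb) (hBq : 0 ≤ Bq)
    (hsmall2 : 2 * (c.C3act * c.ε₁) * Real.exp (5 * r₁ + 1) * K₀ 64 8 * 9 * 64 ≤ 1)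
    (hMv : 0 ≤ Mv)
    (hBqv : 2 * (Real.exp 1 * 9 * 64 * K₀ 64 8 ^ 2 * (2 * (c.C3act * c.ε₁))) * ((1 - cA)⁻¹ ^ 2 * Mv) * (1 + cS) ^ 2 ≤ Bq)
    (hρb1 : ρb < 1)
    -- the laws of the unscaled boxes (W1-12 §2) and `χᵘχᶜᵘ ≤ 1` (products of characteristic functions), slice-free
    (hBox : ∀ (K k : ℕ) (Z : (domSys (F.P K) M (k + 1)).Dom) (s : TermLabel (F.P K) M k L), (𝔇 K k).UnscaledBoxLaws (χu K k) (χcu K k) Z s)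
    (hχ1 : ∀ (K k : ℕ) (Z : (domSys (F.P K) M (k + 1)).Dom) (s : TermLabel (F.P K) M k L) (A : ((𝔇 K k).𝒦 Z s).Λ → ℝ), χu K k Z s A * χcu K k Z s A ≤ 1)
    -- THE LOCATED FAMILY: per slice, base point and admissible history ONE `Inputs226Holo` record, ONE `LocalGrowthInputs` record and the rows (r1)–(r6)
    (hιc : ∀ (K k : ℕ) (old : OlderTerms (F.P K) 𝔸 M k), old ∈ AdmHist (sp K) E₀ r₁ k ∧ old 0 = 0 → ∀ (X : (domSys (F.P K) M (k + 1)).Dom), ∀ φ ∈ sp K (k + 1) X,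
      ∀ Z : (domSys (F.P K) M (k + 1)).Dom, Subtype.val Z ⊆ Subtype.val X → ∀ s ∈ terms L M Z, ∀ t ∈ Ioc (0 : ℝ) θ.γ,
        ∃ ι : (𝔇 K k).Inputs226Holo c Z s ((t : ℝ) : ℂ) old φ a a₅, ∃ ag : (𝔇 K k).AnalyticGrowthInputs (χu K k) (𝒲 K k) (𝒪 K k) Z s old φ ι.Uτ,
        ∃ KE KG' KCs' θΓ' θC' θE' am wm δ : ℝ,
          0 ≤ KE ∧
          (∀ b b', ‖(((𝔇 K k).𝒦 Z s).C⁻¹.map (algebraMap ℝ ℂ)) b b'‖ ≤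
            KE * Real.exp (-(ι.kap * tdist1 (𝔇 K k).Nf (((𝔇 K k).𝒦 Z s).locΛ b) (((𝔇 K k).𝒦 Z s).locΛ b')))) ∧
          (1 + ρb) * ι.KG ≤ KG' ∧ ((1 - ρb) ^ 2)⁻¹ * ι.KCs ≤ KCs' ∧ ι.θΓ + ρb * ι.KG ≤ θΓ' ∧
          ι.θC + ρb * (2 + ρb) * ((1 - ρb) ^ 2)⁻¹ * ι.KCs ≤ θC' ∧ ι.θE + ρb * (2 + ρb) * (ι.θE + KE) ≤ θE' ∧ θE' ≤ ι.θ ∧ θΓ' ≤ ι.θ ∧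
          ((((𝔇 K k).𝒦 Z s).m * (1 + 2 / (ι.kap - ι.kap')) ^ (𝔇 K k).ν) * (((𝔇 K k).𝒦 Z s).m * (1 + 2 / (ι.kap' - ι.kap'')) ^ (𝔇 K k).ν)
            * (θΓ' * KCs' * KG' + ι.KΓ * θC' * KG' + ι.KΓ * ι.K₀ * θΓ') ≤ ι.θ) ∧
          (1 + ρb) ^ 2 * (2 * ag.ρ * (ag.Cp * K₀ (4 * 2 ^ (F.P K).d) (2 * (F.P K).d))) ≤ am ∧ (1 + ρb) ^ 2 * (∑ Y ∈ s.1, ag.Rτ Y * (ag.M𝒪 Y + (2 * ag.M𝒪 Y / ag.R) * ag.ρ)) ≤ wm ∧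
          0 < δ ∧ 2 * δ + 8 * ag.ρ * (ag.Cp * K₀ (4 * 2 ^ (F.P K).d) (2 * (F.P K).d)) ≤ am ∧
          Real.exp (∑ Y ∈ s.1, ag.Rτ Y * ag.M𝒪 Y)
              * ((∑ Y ∈ s.1, ag.Rτ Y * ((4 * (2 * ag.M𝒲 Y / ag.R ^ 4) + (4 * (ag.M𝒲 Y / ag.R ^ 3) + 4 * (ag.M𝒲 Y / ag.R ^ 3)) / ag.ρ) * (4 / (Real.exp 1 * δ)) ^ 4
                    + ((4 * ag.M𝒪 Y / ag.R ^ 2) + ((2 * ag.M𝒪 Y / ag.R) + (2 * ag.M𝒪 Y / ag.R)) / ag.ρ) * (2 / (Real.exp 1 * δ)) ^ 2)) * Real.exp (δ / 2)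
                 + ((∑ Y ∈ s.1, ag.Rτ Y * (4 * (ag.M𝒲 Y / ag.R ^ 3) * (3 / (Real.exp 1 * δ)) ^ 3 + (2 * ag.M𝒪 Y / ag.R) * (1 / (Real.exp 1 * δ))))
                      * Real.exp (δ / 2)) ^ 2
                    * Real.exp ((∑ Y ∈ s.1, ag.Rτ Y * (ag.M𝒪 Y + (2 * ag.M𝒪 Y / ag.R) * ag.ρ)) + ∑ Y ∈ s.1, ag.Rτ Y * ag.M𝒪 Y))
              ≤ Real.exp wm ∧
          (2 * (ι.θ * (((𝔇 K k).𝒦 Z s).m * (1 + 2 / ι.kap'') ^ (𝔇 K k).ν)) + (ι.γ₂ + am)) * ι.cE ≤ 1 / 2 ∧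
          (2 * (ι.θ * (((𝔇 K k).𝒦 Z s).m * (1 + 2 / ι.kap'') ^ (𝔇 K k).ν)) + (ι.γ₂ + am)) * (1 + 2 * ι.cE * ι.g) ≤ 1 / 2 ∧
          2 * (ι.K₀ * (((𝔇 K k).𝒦 Z s).m * (1 + 2 / ι.kap) ^ (𝔇 K k).ν) * (ι.θ * (((𝔇 K k).𝒦 Z s).m * (1 + 2 / ι.kap'') ^ (𝔇 K k).ν))
              * (1 + (1 - ι.K₀ * (((𝔇 K k).𝒦 Z s).m * (1 + 2 / ι.kap) ^ (𝔇 K k).ν) * (ι.θ * (((𝔇 K k).𝒦 Z s).m * (1 + 2 / ι.kap'') ^ (𝔇 K k).ν)))⁻¹) / 2)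
              * (Fintype.card ((𝔇 K k).𝒦 Z s).Λ : ℝ)
            + wm + (2 * (ι.θ * (((𝔇 K k).𝒦 Z s).m * (1 + 2 / ι.kap'') ^ (𝔇 K k).ν)) + (ι.γ₂ + am)) * ι.cE * (Fintype.card ((𝔇 K k).𝒦 Z s).Λ : ℝ)
            + (2 * (ι.θ * (((𝔇 K k).𝒦 Z s).m * (1 + 2 / ι.kap'') ^ (𝔇 K k).ν)) + (ι.γ₂ + am)) * (1 + 2 * ι.cE * ι.g)
              * (Fintype.card (((𝔇 K k).𝒦 Z s).Λ ⊕ ((𝔇 K k).𝒦 Z s).C₀) : ℝ)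
            ≤ a₅ * ((Z.1).card : ℝ) ∧
          (s.2.card = 0 → ∃ κb Rb T : ℝ, 0 ≤ κb ∧ κb ≤ ι.γ₂ + am ∧
            (∀ B : ((𝔇 K k).𝒦 Z s).Λ → ℝ, B ⬝ᵥ B < Rb ^ 2 → χu K k Z s (t • B) * χcu K k Z s (t • B) = 1) ∧
            Real.exp (-(κb / 2 * Rb ^ 2)) ≤ T * t ^ 2 ∧ 1 + T ≤ Mv) ∧
          (s.2.card ≠ 0 → ∃ r₁' T' : ℝ, r₁' ^ 2 ≤ ι.rP ^ 2 ∧ a ≤ ι.γ₂ * r₁' ^ 2 ∧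
            Real.exp (-(ι.γ₂ / 2 * (ι.rP ^ 2 - r₁' ^ 2))) ≤ T' * t ^ 2 ∧ T' ≤ Mv))
    (Ec : ℕ → ℕ → Type*) [∀ K k, NormedAddCommGroup (Ec K k)] [∀ K k, NormedSpace ℂ (Ec K k)]
    (ι : letI := θ.instVβ₁; letI := θ.instVβ₂
      (K k : ℕ) → (domSys (F.P K) M (k + 1)).Dom → ((Fin (F.P K).d → Site (F.P K) (k + 1) → θ.Vβ) →L[ℝ] Ec K k))
    (Φ : (K k : ℕ) → (domSys (F.P K) M (k + 1)).Dom → Ec K k → CPair (F.P K) 𝔸)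
    (U : (K k : ℕ) → (domSys (F.P K) M (k + 1)).Dom → Set (Ec K k)) (hU : ∀ K k X, IsOpen (U K k X)) (hrU : ∀ K k X, ball (0 : Ec K k) r ⊆ U K k X)
    (hΦhol : ∀ (K k : ℕ) (X : (domSys (F.P K) M (k + 1)).Dom), DifferentiableOn ℂ (Φ K k X) (U K k X))
    (hΦemb : letI := θ.instVβ₁; letI := θ.instVβ₂
      ∀ (K k : ℕ) (X : (domSys (F.P K) M (k + 1)).Dom) (Bf : Fin (F.P K).d → Site (F.P K) (k + 1) → θ.Vβ),
        Φ K k X (ι K k X Bf) = emb K k (fun l t => NormedSpace.exp (θ.ρ8 (Bf l t))))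
    (hΦsp : ∀ (K k : ℕ) (X : (domSys (F.P K) M (k + 1)).Dom), ∀ z ∈ U K k X, ∀ Z : (domSys (F.P K) M (k + 1)).Dom, Z.1 ⊆ X.1 → Φ K k X z ∈ sp K (k + 1) Z)
    (w : (K k : ℕ) → (domSys (F.P K) M (k + 1)).Dom → Site (F.P K) (k + 1) → ℝ) (hw₀ : ∀ K k X t, 0 ≤ w K k X t)
    (hw : letI := θ.instVβ₁; letI := θ.instVβ₂; letI := θ.instιβ
      ∀ (K k : ℕ) (X : (domSys (F.P K) M (k + 1)).Dom) (l : Fin (F.P K).d) (t : Site (F.P K) (k + 1)) (c : θ.ιβ),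
        ‖ι K k X (Pi.single l (Pi.single t (θ.bV c)))‖ ≤ w K k X t)
    (htail : ∀ (K k : ℕ) (X : (domSys (F.P K) M (k + 1)).Dom) (t : Site (F.P K) (k + 1)),
      let e : Site (F.P K) (k + 1) → TPt 4 (domCount (F.P K) M (k + 1) * M) := fun x i => (ZMod.cast (x i) : ZMod (domCount (F.P K) M (k + 1) * M))
      w K k X t ≤ B₃ * Real.exp (-δ₀ * distCT (domCount (F.P K) M (k + 1)) M (e t) (nearT (M := M) (e t) X)))
    (hκ₅ : delta1 δ₀ κ ((M : ℝ) * 4) ≤ κ₅)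
    (hω : 0 < ℓ.ω) (hθω : ℓ.θ₅ ≤ ℓ.ω ^ 2) (hℓκ : ℓ.κ ≤ delta1 δ₀ κ ((M : ℝ) * 4))
    (hC₉ : (4 * (2 * C₅ / (1 - ℓ.θ₅) + 2 * ((16 * Mb * B₃ ^ 2 / r ^ 2) * Real.exp (delta1 δ₀ κ ((M : ℝ) * 4) * ((M : ℝ) * 4) * 3) * K₀ (4 * 2 ^ 4) (2 * 4) * K₁ 4 (δ₀ / 2))) / θ.γ +
        ((16 * max ((6 * cS ^ 2 + 32 * cS + 64) / cS ^ 2 * Bq) (64 * Mb * cw ^ 2 / ϱ ^ 2 * (Bq * θ.γ / cS) ^ 2 / (1 - 4 * Mb * cw / ϱ)) * B₃ ^ 2 / r ^ 2) * Real.exp (delta1 δ₀ κ ((M : ℝ) * 4) * ((M : ℝ) * 4) * 3) * K₀ (4 * 2 ^ 4) (2 * 4) *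
          K₁ 4 (δ₀ / 2)) * θ.γ / 2) / ℓ.ω ≤ ℓ.C₉) (k : ℕ) :
    N22At (u3OfRecord₁₃ θ (objectsOfRecord₁₃ F N θ ℓ) k) := by
  have hA6 : 0 ≤ c.α₆ * c.eps2 := mul_nonneg hN.hα₆.le hN.hε₀
  have hρb0 : 0 ≤ ρb := (radius_pos_of_aperture (hcS.trans hcSA) hcA1 hρb).le
  have hγw : θ.γ ∈ Ioc (0 : ℝ) θ.γ := ⟨hγ, le_rfl⟩
  -- per slice and base point: (ι, ofAnalytic ag, rows) ⟹ (hMdiff) ∧ (hMbd) by J88-A §1 (rows match by `rfl` through `ofAnalytic`), boxes at the base point by the law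
  have hMem : ∀ (K k : ℕ) (old : OlderTerms (F.P K) 𝔸 M k), old ∈ AdmHist (sp K) E₀ r₁ k ∧ old 0 = 0 → ∀ (X : (domSys (F.P K) M (k + 1)).Dom), ∀ φ ∈ sp K (k + 1) X,
      ∀ Z : (domSys (F.P K) M (k + 1)).Dom, Subtype.val Z ⊆ Subtype.val X → ∀ s ∈ terms L M Z, ∀ t ∈ Ioc (0 : ℝ) θ.γ,
        DifferentiableOn ℂ (fun b => (𝔇 K).memberTF (χu K) (χcu K) (𝒲 K) (𝒪 K) t k Z s b old φ) (ball (1 : ℂ) ρb) ∧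
        ∀ b ∈ ball (1 : ℂ) ρb, ‖(𝔇 K).memberTF (χu K) (χcu K) (𝒲 K) (𝒪 K) t k Z s b old φ‖ ≤ weight L M c Z a s * Real.exp (a₅ * ((Z.1).card : ℝ)) := by
    intro K k old hold X φ hφ Z hZ s hs t ht
    obtain ⟨ι, ag, KE, KG', KCs', θΓ', θC', θE', am, wm, δ, hKE, hCE, hKG', hKCs', hθΓ', hθC', hθE', hθEle, hθΓle, hθR1le, ha', hw', -, -, -, hαc,
      hsmall', hvol, -, -⟩ := hιc K k old hold X φ hφ Z hZ s hs t ht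
    exact differentiableOn_and_norm_memberTF_le_weight_of_records (𝔇 K k) (χu K k) (χcu K k) (𝒲 K k) (𝒪 K k) hκ₁ hα₆ Z s old φ ht.1 ι (TermDatum214.LocalGrowthInputs.ofAnalytic ag) (hBox K k Z s)
      ((hlaw K k).chiY₀_eq (𝔇 K k) Z s ht) ((hlaw K k).chicP_eq (𝔇 K k) Z s ht) hρb1 hKE hCE hKG' hKCs' hθΓ' hθC' hθE' hθEle hθΓle hθR1le ha' hw'
      hαc hsmall' hvol
  refine n22At_u3OfRecord₁₃_of_kernelStepRate_termDataTableGermsLocatedRadiiDilatedMembersNonexpansive F N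
    θ ℓ hs hγ hlim hC₅ h5 m' M hM 𝔇 emb hloc sp hsp hκ₀ hδ₀ hB₃ hr hκE hκE0 hE₀ big hbigo hrestr hbig c hL hLc hκ₁ hα₆ hN hloc18 hD χu χcu 𝒲 𝒪 Rd W hlaw hread hmaps hW
    hcont hjc hK hμ hCk hmk hWm hb hbaw hι hA0 hr₁ hrate hKP hκr hrenew hrenewE hawcw hC1 hMb0 hϱ hR hcS hcSA hcA1 hρb hBq hsmall2
    -- the coupling-blind centre (J7a §2 ∕ J8), its `DecidableEq` on the τ-labels pinned to the CLASSICAL instance under which def-W1 ∕ J7a ∕ J8 ∕ J88-A elaborate `term214`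
    -- (this file also sees `B13Carriers.TwoRuns.instDecidableEqTDom` through the N18 chain — README (t34))
    (fun K k Z s old φ => if s.2.card = 0 then
      @term214 ℂ _ _ (TPt (F.P K).d (domCount (F.P K) M (k + 1))) _ (TDom (F.P K).d (L * domCount (F.P K) M (k + 1)))
        (fun a b => Classical.propDecidable (a = b)) (𝔇 K k).r (sigmaList L Z s) (tauList (F.P K) M k L s)
        (core214 ((𝔇 K k).A Z s φ) ((𝔇 K k).Gam Z s φ) (F214 s.2.card (fun _ => (1 : ℝ)) (fun _ => (1 : ℝ)) s.1 (fun Y _ => 𝒪 K k Z s old φ Y 0))) 0 0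
      else 0)
    hMv hBqv
    (fun K k old hold X φ hφ Z hZ s hs t ht => (hMem K k old hold X φ hφ Z hZ s hs t ht).1)
    (fun K k old hold X φ hφ Z hZ s hs t ht => (hMem K k old hold X φ hφ Z hZ s hs t ht).2) ?_ ?_
    Ec ι Φ U hU hrU hΦhol hΦemb hΦsp w hw₀ hw htail hκ₅ hω hθω hℓκ hC₉ k
  · -- hT₀: the centre's weight, J88-A §3 with the record at the base point γ
    intro K k old hold X φ hφ Z hZ s hs
    obtain ⟨ι, ag, KE, KG', KCs', θΓ', θC', θE', am, wm, δ, -, -, -, -, -, -, -, -, -, -, ha', hw', -, -, -, hαc, hsmall', hvol, -, -⟩ :=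
      hιc K k old hold X φ hφ Z hZ s hs θ.γ hγw
    exact norm_centre_le_weight_of_records (𝔇 K k) (χu K k) (𝒲 K k) (𝒪 K k) hκ₁ hα₆ hA6 Z s old φ ι (TermDatum214.LocalGrowthInputs.ofAnalytic ag) hρb0 ha' hw' hαc hsmall' hvol
  · -- hMcen: the centred letter, J88-A §2
    intro K k old hold X φ hφ Z hZ s hs t ht b hb
    obtain ⟨ι, ag, KE, KG', KCs', θΓ', θC', θE', am, wm, δ, hKE, hCE, hKG', hKCs', hθΓ', hθC', hθE', hθEle, hθΓle, hθR1le, ha', hw', hδ, hac, hwc, hαc,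
      hsmall', hvol, hbox0, hsur⟩ := hιc K k old hold X φ hφ Z hZ s hs t ht
    exact norm_memberTF_sub_centre_le_of_records (𝔇 K k) (χu K k) (χcu K k) (𝒲 K k) (𝒪 K k) hκ₁ hα₆ hA6 Z s old φ ht.1 ι (TermDatum214.LocalGrowthInputs.ofAnalytic ag) (hBox K k Z s) (hχ1 K k Z s)
      ((hlaw K k).chiY₀_eq (𝔇 K k) Z s ht) ((hlaw K k).chicP_eq (𝔇 K k) Z s ht) hρb0 hρb1 hKE hCE hKG' hKCs' hθΓ' hθC' hθE' hθEle hθΓle hθR1le ha' hw'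
      hδ hac hwc hαc hsmall' hvol hbox0 hsur b hb

end YMDAG.N22.KernelFading

end
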